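import Summits.CriticalPhenomena.PercolationContinuityZ3.Theorems.PercNearOneGluingNoHeavyLowerTailSahiE3TwoPrimeSlotIneq
import Summits.CriticalPhenomena.PercolationContinuityZ3.Theorems.PercNearOneGluingNoHeavyLowerTailSahiE3CovHit
import Summits.CriticalPhenomena.PercolationContinuityZ3.Theorems.PercNearOneGluingNoHeavyLowerTailSahiC3CubeThreeFKGPrelim
import Literature.Combinatorics.Sahi2008.ProvedCases
import Literature.Probability.LatticeModels.SahiThirdOrderCorrelation
import Mathlib.Combinatorics.SetFamily.FourFunctions
import Mathlib.Order.Irreducible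
import Mathlib.Tactic.Linarith
import Mathlib.Tactic.Ring
import HarnessLib
import HarnessLib.Audit

/-!
# `NoHeavyLowerTail` (crux stmt-CriticalPhenomena-4575), Sahi programme P4 (Holley / monotone coupling):
# FKG SLOT-LOCALITY AT TWO JOIN-PRIMES — Sahi's `C₃` for `(↑j₁ ∪ ↑j₂, A, B)` on every finite distributive lattice

Support file (cell `prim-l12`, seat P4, generation 6; `--supports stmt-CriticalPhenomena-4575`).  No named facts, no sorries;
standard axioms.

## The theorem (new; not in print)

Let `L` be a finite distributive lattice, `μ ≥ 0` a log-supermodular ("FKG") weight on `L` (zeros allowed, not normalised),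
`A, B ⊆ L` up-sets and `j₁, j₂ ∈ L` join-prime (= join-irreducible, `SupPrime`).  Then Sahi's third-order functional of the triple
`(U, A, B)` with `U = ↑j₁ ∪ ↑j₂ = {x | j₁ ≤ x ∨ j₂ ≤ x}` is nonnegative:

  `latticeE3_nonneg_of_supPrime_union : 0 ≤ latticeE3 μ (principalUp j₁ ∪ principalUp j₂) A B`

(`latticeE3 μ U A B = 2Z²·m(U∩A∩B) + m(U)m(A)m(B) − Z·(m(U)m(A∩B) + m(A)m(U∩B) + m(B)m(U∩A))`, `Z = m(L)`, the homogeneous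
form `Z³·E₃` of [Sahi 2008, Conj. 5 at `n = 3`; Lieb–Sahi 2022, (2.1)]).  By the symmetry of `E₃` the two-prime union may sit in
any slot (`…₂`, `…₃`).  On a Boolean lattice `ι → Bool` the coordinates `x_i` are join-prime, so this is Sahi's `C₃` for EVERY FKG
measure in EVERY dimension whenever one slot is `{x | x i ∨ x k}` (`latticeE3_nonneg_cube_or`): the first "slot-local" class for
FKG measures beyond Sahi–Blinovsky's principal slot (`Literature…latticeE3_nonneg_of_principal`, `U = ↑c`), and the FKG
counterpart — for two generators — of the product-measure theorem `SahiHittingSlot.sahiE_three_hit_nonneg` (cell P3, hitting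
events `{ω ∩ S ≠ ∅}` in the first slot, product measures only, any `|S|`).  Previously known for FKG measures: all triples on
lattices with `≤ 4` join-irreducibles (`…SahiC3CubeFourFKGLattices`) and the MEET-local classes of this seat's generation 4
(`…SahiE3PrincipalMeetFKG`, `…SahiE3DeterminedMeetFKG`); here the lattice and the other two slots are arbitrary.

## Proof

Fibre `L` by the lattice homomorphism `x ↦ (j₁ ≤ x, j₂ ≤ x) ∈ Bool × Bool` (join-primality makes it a homomorphism): the four
fibres `F_st` are sublattices, `U = F₁₀ ∪ F₀₁ ∪ F₁₁`, and the four functions theorem [Ahlswede–Daykin] gives, for up-sets `X, Y`,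
`m(X ∩ F_s)·m(Y ∩ F_t) ≤ m(F_{s∧t})·m(X ∩ Y ∩ F_{s∨t})` (`fib_ad`, from the set form of the four functions theorem
`SahiE3CovHit.mass_mul_mass_le'`).  The instances of this one inequality with
`X, Y ∈ {L, A, B, A∩B}` are exactly the hypotheses of the real inequality `SahiE3TwoPrimeSlot.phiM_nonneg`
(`…SahiE3TwoPrimeSlotIneq`: worst admissible `A∩B`-densities, a `ν`-dependent shift of the bottom-fibre weight killing the
`γ₀`-term, and a bilinear form on increments checked on the four generators of the cone of increasing functions on `2²`), and
`latticeE3 μ U A B` is `phiM` of the sixteen fibre masses (`latticeE3_eq_phiM`).  The inequality is tight: `E₃ = 0` for product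
measures on `2²` with `A = ↑1`, `B = ↑2`, `U = A ∪ B`.
-/

namespace Summit.CriticalPhenomena.PercolationContinuityZ3.Theorems.SahiE3TwoPrimeSlot

open Finset Literature.Probability.LatticeModels
open scoped BigOperators

variable {α : Type*} [DistribLattice α] [Fintype α] [DecidableEq α]

/-! ### The four fibres of two join-primes

The fibres of `x ↦ (j₁ ≤ x, j₂ ≤ x)` are passed around as a family `F : Bool → Bool → Finset α` together with its membership
description `hF` (no auxiliary definition is introduced; the main theorem instantiates `F s t = univ.filter …`). -/

omit [Fintype α] [DecidableEq α] in
/-- A join-prime element is below a join iff it is below one of the two (Mathlib's `SupPrime.le_sup`). [folklore] -/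
theorem le_sup_iff_of_supPrime {j x y : α} (hj : SupPrime j) : j ≤ x ⊔ y ↔ j ≤ x ∨ j ≤ y := hj.le_sup

omit [Fintype α] [DecidableEq α] in
/-- Meets of fibre points: `F_st ⊓ F_s't' ⊆ F_{(s∧s')(t∧t')}`. [this work] -/
theorem inf_mem_fib {j₁ j₂ : α} {F : Bool → Bool → Finset α}
    (hF : ∀ (s t : Bool) (x : α), x ∈ F s t ↔ ((j₁ ≤ x ↔ s = true) ∧ (j₂ ≤ x ↔ t = true)))
    {x y : α} {s t s' t' : Bool} (hx : x ∈ F s t) (hy : y ∈ F s' t') : x ⊓ y ∈ F (s && s') (t && t') := by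
  rw [hF] at hx hy ⊢
  rw [le_inf_iff, le_inf_iff, hx.1, hy.1, hx.2, hy.2, Bool.and_eq_true, Bool.and_eq_true]
  exact ⟨Iff.rfl, Iff.rfl⟩

omit [Fintype α] [DecidableEq α] in
/-- Joins of fibre points (join-primality): `F_st ⊔ F_s't' ⊆ F_{(s∨s')(t∨t')}`. [this work] -/
theorem sup_mem_fib {j₁ j₂ : α} (hj₁ : SupPrime j₁) (hj₂ : SupPrime j₂) {F : Bool → Bool → Finset α}
    (hF : ∀ (s t : Bool) (x : α), x ∈ F s t ↔ ((j₁ ≤ x ↔ s = true) ∧ (j₂ ≤ x ↔ t = true)))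
    {x y : α} {s t s' t' : Bool} (hx : x ∈ F s t) (hy : y ∈ F s' t') : x ⊔ y ∈ F (s || s') (t || t') := by
  rw [hF] at hx hy ⊢
  rw [le_sup_iff_of_supPrime hj₁, le_sup_iff_of_supPrime hj₂, hx.1, hy.1, hx.2, hy.2, Bool.or_eq_true, Bool.or_eq_true]
  exact ⟨Iff.rfl, Iff.rfl⟩

omit [DecidableEq α] in
/-- **The one Ahlswede–Daykin inequality that is used**: for up-sets `X, Y` and fibres `F_st`, `F_s't'`,
`m(X ∩ F_st)·m(Y ∩ F_s't') ≤ m(F_{(s∧s')(t∧t')})·m(X ∩ Y ∩ F_{(s∨s')(t∨t')})`. [this work] -/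
theorem fib_ad [DecidableEq α] {μ : α → ℝ} (hμ₀ : 0 ≤ μ) (hμ : ∀ a b, μ a * μ b ≤ μ (a ⊓ b) * μ (a ⊔ b)) {j₁ j₂ : α}
    (hj₁ : SupPrime j₁) (hj₂ : SupPrime j₂) {F : Bool → Bool → Finset α}
    (hF : ∀ (s t : Bool) (x : α), x ∈ F s t ↔ ((j₁ ≤ x ↔ s = true) ∧ (j₂ ≤ x ↔ t = true)))
    {X Y : Finset α} (hX : IsUpperSet (X : Set α)) (hY : IsUpperSet (Y : Set α)) (s t s' t' : Bool) :
    mass μ (X ∩ F s t) * mass μ (Y ∩ F s' t') ≤ mass μ (F (s && s') (t && t')) * mass μ (X ∩ Y ∩ F (s || s') (t || t')) := by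
  refine SahiE3CovHit.mass_mul_mass_le' hμ₀ hμ fun x hx y hy => ?_
  rw [Finset.mem_inter] at hx hy
  refine ⟨inf_mem_fib hF hx.2 hy.2, ?_⟩
  rw [Finset.mem_inter, Finset.mem_inter]
  exact ⟨⟨hX (show x ≤ x ⊔ y from le_sup_left) hx.1, hY (show y ≤ x ⊔ y from le_sup_right) hy.1⟩,
    sup_mem_fib hj₁ hj₂ hF hx.2 hy.2⟩

/-! ### Masses split along the fibres -/

section Split

variable [DecidableLE α]

omit [Fintype α] in
/-- `m(S) = Σ_{s,t} m(S ∩ F_st)`. [this work] -/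
theorem mass_eq_sum_fib (μ : α → ℝ) {j₁ j₂ : α} {F : Bool → Bool → Finset α}
    (hF : ∀ (s t : Bool) (x : α), x ∈ F s t ↔ ((j₁ ≤ x ↔ s = true) ∧ (j₂ ≤ x ↔ t = true))) (S : Finset α) :
    mass μ S = mass μ (S ∩ F false false) + mass μ (S ∩ F true false) + mass μ (S ∩ F false true) + mass μ (S ∩ F true true) := by
  have h1 := Finset.sum_filter_add_sum_filter_not S (fun x => j₁ ≤ x) μ
  have h2 := Finset.sum_filter_add_sum_filter_not (S.filter fun x => j₁ ≤ x) (fun x => j₂ ≤ x) μ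
  have h3 := Finset.sum_filter_add_sum_filter_not (S.filter fun x => ¬ j₁ ≤ x) (fun x => j₂ ≤ x) μ
  have e11 : (S.filter fun x => j₁ ≤ x).filter (fun x => j₂ ≤ x) = S ∩ F true true := by
    ext x; rw [Finset.mem_inter, hF]; simp [and_assoc]
  have e10 : (S.filter fun x => j₁ ≤ x).filter (fun x => ¬ j₂ ≤ x) = S ∩ F true false := by
    ext x; rw [Finset.mem_inter, hF]; simp [and_assoc]
  have e01 : (S.filter fun x => ¬ j₁ ≤ x).filter (fun x => j₂ ≤ x) = S ∩ F false true := by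
    ext x; rw [Finset.mem_inter, hF]; simp [and_assoc]
  have e00 : (S.filter fun x => ¬ j₁ ≤ x).filter (fun x => ¬ j₂ ≤ x) = S ∩ F false false := by
    ext x; rw [Finset.mem_inter, hF]; simp [and_assoc]
  unfold mass
  rw [← h1, ← h2, ← h3, e11, e10, e01, e00]
  ring

/-- `m((↑j₁ ∪ ↑j₂) ∩ S) = m(S ∩ F₁₀) + m(S ∩ F₀₁) + m(S ∩ F₁₁)`. [this work] -/
theorem mass_union_inter_eq (μ : α → ℝ) {j₁ j₂ : α} {F : Bool → Bool → Finset α}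
    (hF : ∀ (s t : Bool) (x : α), x ∈ F s t ↔ ((j₁ ≤ x ↔ s = true) ∧ (j₂ ≤ x ↔ t = true))) (S : Finset α) :
    mass μ ((principalUp j₁ ∪ principalUp j₂) ∩ S) = mass μ (S ∩ F true false) + mass μ (S ∩ F false true) + mass μ (S ∩ F true true) := by
  rw [mass_eq_sum_fib μ hF ((principalUp j₁ ∪ principalUp j₂) ∩ S)]
  have e00 : (principalUp j₁ ∪ principalUp j₂) ∩ S ∩ F false false = ∅ := by
    ext x
    rw [Finset.mem_inter, Finset.mem_inter, Finset.mem_union, mem_principalUp, mem_principalUp, hF]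
    simp only [Finset.notMem_empty, iff_false, Bool.false_eq_true]
    tauto
  have e10 : (principalUp j₁ ∪ principalUp j₂) ∩ S ∩ F true false = S ∩ F true false := by
    ext x
    rw [Finset.mem_inter, Finset.mem_inter, Finset.mem_inter, Finset.mem_union, mem_principalUp, mem_principalUp, hF]
    simp only [Bool.false_eq_true, iff_false]
    tauto
  have e01 : (principalUp j₁ ∪ principalUp j₂) ∩ S ∩ F false true = S ∩ F false true := by
    ext x
    rw [Finset.mem_inter, Finset.mem_inter, Finset.mem_inter, Finset.mem_union, mem_principalUp, mem_principalUp, hF]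
    simp only [Bool.false_eq_true, iff_false]
    tauto
  have e11 : (principalUp j₁ ∪ principalUp j₂) ∩ S ∩ F true true = S ∩ F true true := by
    ext x
    rw [Finset.mem_inter, Finset.mem_inter, Finset.mem_inter, Finset.mem_union, mem_principalUp, mem_principalUp, hF]
    tauto
  rw [e00, e10, e01, e11]
  unfold mass; simp

/-- `latticeE3 μ (↑j₁ ∪ ↑j₂) A B` is the cubic `phiM` of `…SahiE3TwoPrimeSlotIneq` evaluated at the sixteen fibre masses.
[this work] -/
theorem latticeE3_eq_phiM (μ : α → ℝ) {j₁ j₂ : α} {F : Bool → Bool → Finset α}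
    (hF : ∀ (s t : Bool) (x : α), x ∈ F s t ↔ ((j₁ ≤ x ↔ s = true) ∧ (j₂ ≤ x ↔ t = true))) (A B : Finset α) :
    latticeE3 μ (principalUp j₁ ∪ principalUp j₂) A B =
      (2 * (mass μ (F false false) + mass μ (F true false) + mass μ (F false true) + mass μ (F true true)) ^ 2 * (mass μ (A ∩ B ∩ F true false) + mass μ (A ∩ B ∩ F false true) + mass μ (A ∩ B ∩ F true true))
    + (mass μ (F true false) + mass μ (F false true) + mass μ (F true true)) * (mass μ (A ∩ F false false) + mass μ (A ∩ F true false) + mass μ (A ∩ F false true) + mass μ (A ∩ F true true)) * (mass μ (B ∩ F false false) + mass μ (B ∩ F true false) + mass μ (B ∩ F false true) + mass μ (B ∩ F true true))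
    - (mass μ (F false false) + mass μ (F true false) + mass μ (F false true) + mass μ (F true true)) * ((mass μ (F true false) + mass μ (F false true) + mass μ (F true true)) * (mass μ (A ∩ B ∩ F false false) + mass μ (A ∩ B ∩ F true false) + mass μ (A ∩ B ∩ F false true) + mass μ (A ∩ B ∩ F true true)) + (mass μ (A ∩ F false false) + mass μ (A ∩ F true false) + mass μ (A ∩ F false true) + mass μ (A ∩ F true true)) * (mass μ (B ∩ F true false) + mass μ (B ∩ F false true) + mass μ (B ∩ F true true))
        + (mass μ (B ∩ F false false) + mass μ (B ∩ F true false) + mass μ (B ∩ F false true) + mass μ (B ∩ F true true)) * (mass μ (A ∩ F true false) + mass μ (A ∩ F false true) + mass μ (A ∩ F true true)))) := by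
  have hZ := mass_eq_sum_fib μ hF (univ : Finset α)
  rw [Finset.univ_inter, Finset.univ_inter, Finset.univ_inter, Finset.univ_inter] at hZ
  have hA := mass_eq_sum_fib μ hF A
  have hB := mass_eq_sum_fib μ hF B
  have hAB := mass_eq_sum_fib μ hF (A ∩ B)
  have hU := mass_union_inter_eq μ hF (univ : Finset α)
  rw [Finset.inter_univ, Finset.univ_inter, Finset.univ_inter, Finset.univ_inter] at hU
  have hUA := mass_union_inter_eq μ hF A
  have hUB := mass_union_inter_eq μ hF B
  have hUAB := mass_union_inter_eq μ hF (A ∩ B)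
  unfold latticeE3
  rw [Finset.inter_assoc (principalUp j₁ ∪ principalUp j₂) A B, hUAB, hUA, hUB, hU, hZ, hA, hB, hAB]

end Split

/-! ### The theorem -/

omit [DistribLattice α] [DecidableEq α] in
/-- `univ` is an up-set. [folklore] -/
theorem isUpperSet_coe_univ [Preorder α] : IsUpperSet ((univ : Finset α) : Set α) := by
  rw [Finset.coe_univ]; exact isUpperSet_univ

/-- **FKG slot-locality at two join-primes.**  For every nonnegative log-supermodular weight `μ` on a finite distributive lattice,
up-sets `A, B` and join-prime `j₁, j₂`: `0 ≤ latticeE3 μ (↑j₁ ∪ ↑j₂) A B` — Sahi's `C₃` for the triple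
`({x | j₁ ≤ x ∨ j₂ ≤ x}, A, B)`. [this work] -/
theorem latticeE3_nonneg_of_supPrime_union [DecidableLE α] {μ : α → ℝ} (hμ₀ : 0 ≤ μ)
    (hμ : ∀ a b, μ a * μ b ≤ μ (a ⊓ b) * μ (a ⊔ b)) {j₁ j₂ : α} (hj₁ : SupPrime j₁) (hj₂ : SupPrime j₂) {A B : Finset α}
    (hA : IsUpperSet (A : Set α)) (hB : IsUpperSet (B : Set α)) : 0 ≤ latticeE3 μ (principalUp j₁ ∪ principalUp j₂) A B := by
  have hF : ∀ (s t : Bool) (x : α), x ∈ (fun s t : Bool => univ.filter fun x : α => (j₁ ≤ x ↔ s = true) ∧ (j₂ ≤ x ↔ t = true)) s t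
      ↔ ((j₁ ≤ x ↔ s = true) ∧ (j₂ ≤ x ↔ t = true)) := by
    intro s t x; simp
  have hAB : IsUpperSet ((A ∩ B : Finset α) : Set α) := by rw [Finset.coe_inter]; exact hA.inter hB
  have hU : IsUpperSet ((univ : Finset α) : Set α) := isUpperSet_coe_univ
  have ad := fun {X Y : Finset α} (hX : IsUpperSet (X : Set α)) (hY : IsUpperSet (Y : Set α)) (s t s' t' : Bool) =>
    fib_ad hμ₀ hμ hj₁ hj₂ hF hX hY s t s' t'
  rw [latticeE3_eq_phiM μ hF]
  refine phiM_nonneg (mass_nonneg hμ₀ _) (mass_nonneg hμ₀ _) (mass_nonneg hμ₀ _) (mass_nonneg hμ₀ _) ?_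
    (mass_nonneg hμ₀ _) (mass_nonneg hμ₀ _) (mass_nonneg hμ₀ _) (mass_nonneg hμ₀ _)
    (mass_mono hμ₀ Finset.inter_subset_right) (mass_mono hμ₀ Finset.inter_subset_right)
    (mass_mono hμ₀ Finset.inter_subset_right) (mass_mono hμ₀ Finset.inter_subset_right)
    (mass_nonneg hμ₀ _) (mass_nonneg hμ₀ _) (mass_nonneg hμ₀ _) (mass_nonneg hμ₀ _)
    (mass_mono hμ₀ Finset.inter_subset_right) (mass_mono hμ₀ Finset.inter_subset_right)
    (mass_mono hμ₀ Finset.inter_subset_right) (mass_mono hμ₀ Finset.inter_subset_right)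
    (mass_nonneg hμ₀ _) (mass_nonneg hμ₀ _) (mass_nonneg hμ₀ _) (mass_nonneg hμ₀ _)
    (mass_mono hμ₀ Finset.inter_subset_right) (mass_mono hμ₀ Finset.inter_subset_right)
    (mass_mono hμ₀ Finset.inter_subset_right) (mass_mono hμ₀ Finset.inter_subset_right)
    ?_ ?_ ?_ ?_ ?_ ?_ ?_ ?_ ?_ ?_ ?_ ?_ ?_ ?_ ?_ ?_
  · simpa using ad hU hU true false false true
  · simpa using ad hA hU false false true false
  · simpa using ad hA hU false false false true
  · simpa using ad hA hU true false true true
  · simpa using ad hA hU false true true true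
  · simpa using ad hA hU false false true true
  · simpa using ad hB hU false false true false
  · simpa using ad hB hU false false false true
  · simpa using ad hB hU true false true true
  · simpa using ad hB hU false true true true
  · simpa using ad hB hU false false true true
  · simpa using ad hAB hU false false true false
  · simpa using ad hAB hU false false false true
  · simpa using ad hAB hU false false true true
  · simpa using ad hA hB true false true false
  · simpa using ad hA hB false true false true
  · simpa using ad hA hB true true true true

/-! ### Corollaries: join-irreducibles, the other slots, Sahi's `E₃` for FKG probability weights, Boolean lattices -/

section Corollaries

variable [DecidableLE α] {μ : α → ℝ}

/-- The same with join-IRREDUCIBLE `j₁, j₂` (equivalent to join-prime on a distributive lattice). [this work] -/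
theorem latticeE3_nonneg_of_supIrred_union (hμ₀ : 0 ≤ μ) (hμ : ∀ a b, μ a * μ b ≤ μ (a ⊓ b) * μ (a ⊔ b))
    {j₁ j₂ : α} (hj₁ : SupIrred j₁) (hj₂ : SupIrred j₂) {A B : Finset α} (hA : IsUpperSet (A : Set α))
    (hB : IsUpperSet (B : Set α)) : 0 ≤ latticeE3 μ (principalUp j₁ ∪ principalUp j₂) A B :=
  latticeE3_nonneg_of_supPrime_union hμ₀ hμ hj₁.supPrime hj₂.supPrime hA hB

/-- The two-prime union in the second slot. [this work] -/
theorem latticeE3_nonneg_of_supPrime_union₂ (hμ₀ : 0 ≤ μ) (hμ : ∀ a b, μ a * μ b ≤ μ (a ⊓ b) * μ (a ⊔ b))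
    {j₁ j₂ : α} (hj₁ : SupPrime j₁) (hj₂ : SupPrime j₂) {A B : Finset α} (hA : IsUpperSet (A : Set α))
    (hB : IsUpperSet (B : Set α)) : 0 ≤ latticeE3 μ A (principalUp j₁ ∪ principalUp j₂) B := by
  rw [SahiC3Cube.latticeE3_comm₁₂]; exact latticeE3_nonneg_of_supPrime_union hμ₀ hμ hj₁ hj₂ hA hB

/-- The two-prime union in the third slot. [this work] -/
theorem latticeE3_nonneg_of_supPrime_union₃ (hμ₀ : 0 ≤ μ) (hμ : ∀ a b, μ a * μ b ≤ μ (a ⊓ b) * μ (a ⊔ b))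
    {j₁ j₂ : α} (hj₁ : SupPrime j₁) (hj₂ : SupPrime j₂) {A B : Finset α} (hA : IsUpperSet (A : Set α))
    (hB : IsUpperSet (B : Set α)) : 0 ≤ latticeE3 μ A B (principalUp j₁ ∪ principalUp j₂) := by
  rw [SahiC3Cube.latticeE3_comm₁₃]; exact latticeE3_nonneg_of_supPrime_union hμ₀ hμ hj₁ hj₂ hB hA

open Literature.Combinatorics.Sahi2008 in
/-- **Sahi's `E₃(1_{↑j₁ ∪ ↑j₂}, 1_A, 1_B) ≥ 0` for every FKG probability weight** on a finite distributive lattice (the `n = 3`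
functional of the tree's `SahiConjecture`, Literature `sahiE μ 3`), `A, B` increasing events, `j₁, j₂` join-prime. [this work] -/
theorem sahiE_three_nonneg_of_supPrime_union (hμ : IsFKGMeasure μ) {j₁ j₂ : α} (hj₁ : SupPrime j₁) (hj₂ : SupPrime j₂)
    {A B : Finset α} (hA : IsUpperSet (A : Set α)) (hB : IsUpperSet (B : Set α)) :
    0 ≤ sahiE μ 3 ![setInd (principalUp j₁ ∪ principalUp j₂), setInd A, setInd B] := by
  rw [sahiE_three_indicator_eq_latticeE3 hμ.sum_eq_one]
  exact latticeE3_nonneg_of_supPrime_union hμ.nonneg hμ.mul_le_mul hj₁ hj₂ hA hB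

open Literature.Combinatorics.Sahi2008 Function in
/-- **Function form.**  For an FKG probability weight, join-prime `j₁, j₂` and nonnegative monotone `g, h`:
`E₃(1_{↑j₁ ∪ ↑j₂}, g, h) ≥ 0` (layer cake in the two free slots). [this work] -/
theorem sahiE_three_nonneg_of_supPrime_union_of_monotone (hμ : IsFKGMeasure μ) {j₁ j₂ : α} (hj₁ : SupPrime j₁)
    (hj₂ : SupPrime j₂) {g h : α → ℝ} (hg : ∀ x, 0 ≤ g x) (hgm : Monotone g) (hh : ∀ x, 0 ≤ h x) (hhm : Monotone h) :
    0 ≤ sahiE μ 3 ![setInd (principalUp j₁ ∪ principalUp j₂), g, h] := by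
  obtain ⟨lg, hlg, hglg⟩ := exists_upperSet_decomposition g hg hgm
  obtain ⟨lh, hlh, hhlh⟩ := exists_upperSet_decomposition h hh hhm
  have h1 : ∀ φ : α → ℝ, (![setInd (principalUp j₁ ∪ principalUp j₂), φ, h] : Fin 3 → α → ℝ) =
      update ![setInd (principalUp j₁ ∪ principalUp j₂), 0, h] 1 φ := by
    intro φ; funext i; fin_cases i <;> simp
  rw [h1, hglg, sahiE_update_listSum]
  refine List.sum_nonneg fun t ht => ?_
  obtain ⟨pg, hpg, rfl⟩ := List.mem_map.1 ht
  refine mul_nonneg (hlg pg hpg).1 ?_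
  rw [← h1]
  have h2 : ∀ ψ : α → ℝ, (![setInd (principalUp j₁ ∪ principalUp j₂), setInd pg.2, ψ] : Fin 3 → α → ℝ) =
      update ![setInd (principalUp j₁ ∪ principalUp j₂), setInd pg.2, 0] 2 ψ := by
    intro ψ; funext i; fin_cases i <;> simp
  rw [h2, hhlh, sahiE_update_listSum]
  refine List.sum_nonneg fun t' ht' => ?_
  obtain ⟨ph, hph, rfl⟩ := List.mem_map.1 ht'
  refine mul_nonneg (hlh ph hph).1 ?_
  rw [← h2]
  exact sahiE_three_nonneg_of_supPrime_union hμ hj₁ hj₂ (hlg pg hpg).2 (hlh ph hph).2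

end Corollaries

/-! ### Boolean lattices: the first slot "`ω` meets `{i, k}`" -/

section Boolean

variable {ι : Type*} [Fintype ι] [DecidableEq ι]

/-- `↑{i} ∪ ↑{k} = {ω | i ∈ ω ∨ k ∈ ω}` in `Finset ι`. [this work] -/
theorem principalUp_singleton_union (i k : ι) :
    principalUp ({i} : Finset ι) ∪ principalUp {k} = univ.filter fun ω : Finset ι => i ∈ ω ∨ k ∈ ω := by
  ext ω
  simp [mem_principalUp]

/-- **Sahi's `C₃` on `2^ι` for every FKG weight when one slot is "`ω` meets `{i, k}`"** (`= {ω | i ∈ ω ∨ k ∈ ω}`, the hitting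
event of a two-element set), the other two slots arbitrary up-sets: the FKG-measure counterpart, for `|S| = 2`, of the
product-measure theorem `SahiHittingSlot.sahiE_three_hit_nonneg`. [this work] -/
theorem latticeE3_nonneg_hit_pair {μ : Finset ι → ℝ} (hμ₀ : 0 ≤ μ) (hμ : ∀ a b, μ a * μ b ≤ μ (a ⊓ b) * μ (a ⊔ b))
    (i k : ι) {A B : Finset (Finset ι)} (hA : IsUpperSet (A : Set (Finset ι))) (hB : IsUpperSet (B : Set (Finset ι))) :
    0 ≤ latticeE3 μ (univ.filter fun ω : Finset ι => i ∈ ω ∨ k ∈ ω) A B := by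
  rw [← principalUp_singleton_union]
  exact latticeE3_nonneg_of_supPrime_union hμ₀ hμ (SahiE3CovHit.supPrime_singleton' i) (SahiE3CovHit.supPrime_singleton' k) hA hB

end Boolean

end Summit.CriticalPhenomena.PercolationContinuityZ3.Theorems.SahiE3TwoPrimeSlot
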